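import Summits.Ventures.Crystal3D.Kissing125.GSearchRules1
import HarnessLib

/-!
# Soundness of trimming and the pair rule, κ-generic — part 2/2

HONEST FRAMING (cell pub-crystal3d, K-path at `h = 5/4`, V4 = κ as an explicit parameter): this is NOT a result printed
by Hales; it is his METHOD (arXiv:1209.6043, Theorem 3 + Lemmas 7–10, in the tree's form of a verified interval-arithmetic
growth search, `Literature/…/KissingSearch*.lean`) with the largest long-side cosine `κ` made an EXPLICIT PARAMETER
(`κ : Kappa`, carrying the two numeric facts the soundness proof uses: `-1/2 ≤ κ`, `κ < 1/4`).  Only the declarations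
whose statement depends on `κ` are declared here (namespace `…Kissing125.GSearch`, the tree's short names, no renames);
every κ-free helper is the landed K25 copy (`…Kissing125.KissingSearch.*`) and every κ-free lemma is cited from the tree
(PRIVATE per-file citation aliases; `GSearchTransport.lean` holds `toT : St → tree St` and the transport equalities).  The K25
instance is `κ25 = ⟨7/32, …⟩`; `GSearchBridge.lean` identifies the generic checker at
`κ25` with the landed `Kissing125.KissingSearch.checkPart`, so the landed run files are consumed unchanged.  Generated by
`HOME/lean/kissing125/v4-prep/gen/mkgen.py`; nothing here is asserted about GAP(1.26) or any census.

THIS FILE: the κ-tainted declarations of `Literature/Geometry/DiscreteGeometry/KissingSearchRules.lean` (part 2 of 2), with `κ : Kappa` threaded; κ-free declarations of that file are NOT re-declared publicly (the κ-free helpers are the landed K25 copies; the κ-free tree lemmas used by the proofs are cited through PRIVATE aliases at the top of the file).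

## References
* T. C. Hales, *A proof of Fejes Tóth's conjecture on sphere packings with kissing number twelve*,
  arXiv:1209.6043 (2012): Definition 1, Theorem 2, Theorem 3, Lemmas 7–10. [`Hales2012`]
* R. E. Moore, *Interval Analysis* (1966), Theorem 3.1, §4.4. [`Moore1966`]
-/

namespace Summit.Ventures.Crystal3D.Kissing125

open Literature.Geometry.DiscreteGeometry
open Summit.Ventures.Crystal3D.Kissing125.KissingSearch

namespace GSearch

open Real Literature.Analysis.ValidatedNumerics KissingLP NonemptyInterval Finset

variable {κ : Kappa}

/-! ### κ-free tree lemmas used below, read over the K25 copies (PRIVATE citation aliases; the public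
surface of this file is κ-generic only) -/

/-- K25 reading of the tree lemma `ZCELL_eq` (κ-free; proof = citation of the tree lemma). [folklore] -/
private theorem ZCELL_eq : ZCELL = 11 :=
  Literature.Geometry.DiscreteGeometry.KissingSearch.ZCELL_eq

/-- K25 reading of the tree lemma `apexes_eq` (κ-free; proof = citation of the tree lemma). [folklore] -/
private theorem apexes_eq (s : St) (a b : ℕ) :
  s.apexes a b =
    (List.map (fun t ↦ tv0 t + tv1 t + tv2 t - a - b)
        (List.filter (fun t ↦ tmem t a && tmem t b) s.tris.toList)).reverse :=
  Literature.Geometry.DiscreteGeometry.KissingSearch.apexes_eq (toT s) a b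

/-- K25 reading of the tree lemma `eq_of_tset_eq` (κ-free; proof = citation of the tree lemma). [folklore] -/
private theorem eq_of_tset_eq {s t : ℕ} (hs : TriValid s) (ht : TriValid t)
  (hst : tset s = tset t) : s = t :=
  Literature.Geometry.DiscreteGeometry.KissingSearch.eq_of_tset_eq hs ht hst

/-- K25 reading of the tree lemma `foldRange_eq_foldl` (κ-free; proof = citation of the tree lemma). [folklore] -/
private theorem foldRange_eq_foldl {β : Type} (f : β → ℕ → β) (i n : ℕ) (acc : β) :
  foldRange f i n acc = List.foldl f acc (List.range' i n) :=
  by rw [foldRange_tr]; exact Literature.Geometry.DiscreteGeometry.KissingSearch.foldRange_eq_foldl f i n acc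

/-- K25 reading of the tree lemma `lt_of_mem_tset` (κ-free; proof = citation of the tree lemma). [folklore] -/
private theorem lt_of_mem_tset {t v : ℕ} (ht : TriValid t) (hv : v ∈ tset t) : v < 12 :=
  Literature.Geometry.DiscreteGeometry.KissingSearch.lt_of_mem_tset ht hv

/-- K25 reading of the tree lemma `third_vertex` (κ-free; proof = citation of the tree lemma). [folklore] -/
private theorem third_vertex {t a b : ℕ} (ht : TriValid t) (ha : a ∈ tset t)
  (hb : b ∈ tset t) (hab : a ≠ b) :
  tv0 t + tv1 t + tv2 t - a - b ∈ tset t ∧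
    tv0 t + tv1 t + tv2 t - a - b ≠ a ∧
      tv0 t + tv1 t + tv2 t - a - b ≠ b ∧ tset t = {a, b, tv0 t + tv1 t + tv2 t - a - b} :=
  Literature.Geometry.DiscreteGeometry.KissingSearch.third_vertex ht ha hb hab

/-- K25 reading of the tree lemma `tmem_iff` (κ-free; proof = citation of the tree lemma). [folklore] -/
private theorem tmem_iff {t v : ℕ} : tmem t v = true ↔ v ∈ tset t :=
  Literature.Geometry.DiscreteGeometry.KissingSearch.tmem_iff

/-- K25 reading of the tree lemma `validDom_mkR` (κ-free; proof = citation of the tree lemma). [folklore] -/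
private theorem validDom_mkR {lo hi : ℕ} (h1 : 1 ≤ lo) (h2 : lo ≤ hi) (h3 : hi ≤ K) :
  ValidDom (mkR lo hi) :=
  Literature.Geometry.DiscreteGeometry.KissingSearch.validDom_mkR h1 h2 h3

/-- K25 reading of the tree lemma `tris_sdom` (κ-free; proof = citation of the tree lemma). [folklore] -/
@[simp] private theorem tris_sdom {s : St} (a b r : ℕ) : (s.sdom a b r).tris = s.tris :=
  Literature.Geometry.DiscreteGeometry.KissingSearch.tris_sdom (s := toT s) a b r

/-- K25 reading of the tree lemma `sc_sdom` (κ-free; proof = citation of the tree lemma). [folklore] -/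
@[simp] private theorem sc_sdom {s : St} (a b r : ℕ) : (s.sdom a b r).sc = s.sc :=
  Literature.Geometry.DiscreteGeometry.KissingSearch.sc_sdom (s := toT s) a b r

/-- K25 reading of the tree lemma `size_dom_sdom` (κ-free; proof = citation of the tree lemma). [folklore] -/
@[simp] private theorem size_dom_sdom {s : St} (a b r : ℕ) :
  (s.sdom a b r).dom.size = s.dom.size :=
  Literature.Geometry.DiscreteGeometry.KissingSearch.size_dom_sdom (s := toT s) a b r

/-- K25 reading of the tree lemma `gsc_sdom` (κ-free; proof = citation of the tree lemma). [folklore] -/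
@[simp] private theorem gsc_sdom {s : St} (a b r p q : ℕ) :
  (s.sdom a b r).gsc p q = s.gsc p q :=
  Literature.Geometry.DiscreteGeometry.KissingSearch.gsc_sdom (s := toT s) a b r p q


/-- In a realized state, two placed triangles on a labelled-contact configuration around a long
side force its cosine to be nonnegative. **Soundness of `pairRuleAt`.**
[cite: Hales2012, proof of Theorem 2] -/
theorem pairRuleAt_sound {M : KConf κ} {s : St} (hR : Realizes M s) {a b : ℕ} (ha : a < 12) (hb : b < 12)
    (hab : a ≠ b) :
    s.pairRuleAt a b ≠ none ∧ ∀ s', s.pairRuleAt a b = some s' → Realizes M s' ∧ s'.tris = s.tris := by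
  unfold St.pairRuleAt
  simp only
  by_cases htriv : s.gdom a b = 0 ∨ s.gdom a b = UNL ∨ s.gsc a b ≠ 2
  · rw [if_pos htriv]; exact ⟨by simp, fun s' h => by cases h; exact ⟨hR, rfl⟩⟩
  · rw [if_neg htriv]
    simp only [not_or, not_not] at htriv
    obtain ⟨hr0, hrU, hsc2⟩ := htriv
    by_cases hcond : (s.apexes a b).length = 2 ∧ (s.apexes a b).all (fun w => s.gdom w a == 0 && s.gdom w b == 0) = true
    · rw [if_pos hcond]
      -- the geometry: `0 ≤ g a b`
      have hsem := hR.dom a b ha hb hab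
      rcases hsem with h | ⟨h, -⟩ | ⟨vd, -, hxne, hxlo, hxhi⟩
      · exact absurd h hrU
      · exact absurd h hr0
      rcases vd with h | ⟨hl1, hl2, hl3, hl4⟩
      · exact absurd h hr0
      -- the two placed triangles through `{a, b}`
      set F := s.tris.toList.filter (fun t => tmem t a && tmem t b) with hF
      have hlen : F.length = 2 := by rw [hF, ← hR.sc_eq a b ha hb hab]; exact hsc2
      obtain ⟨t1, t2, hF12⟩ : ∃ t1 t2, F = [t1, t2] := by
        match F, hlen with
        | [t1, t2], _ => exact ⟨t1, t2, rfl⟩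
      have ht1F : t1 ∈ F := by rw [hF12]; simp
      have ht2F : t2 ∈ F := by rw [hF12]; simp
      have hnd : F.Nodup := hR.nodup.filter _
      have ht12 : t1 ≠ t2 := by
        rw [hF12] at hnd
        simp only [List.nodup_cons, List.mem_singleton, List.not_mem_nil, not_false_eq_true,
          List.nodup_nil, and_true] at hnd
        exact hnd
      rw [hF, List.mem_filter] at ht1F ht2F
      obtain ⟨ht1, hm1⟩ := ht1F
      obtain ⟨ht2, hm2⟩ := ht2F
      simp only [Bool.and_eq_true] at hm1 hm2
      have v1 := hR.valid t1 ht1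
      have v2 := hR.valid t2 ht2
      have a1 : a ∈ tset t1 := tmem_iff.1 hm1.1
      have b1 : b ∈ tset t1 := tmem_iff.1 hm1.2
      have a2 : a ∈ tset t2 := tmem_iff.1 hm2.1
      have b2 : b ∈ tset t2 := tmem_iff.1 hm2.2
      obtain ⟨w1m, w1a, w1b, hset1⟩ := third_vertex v1 a1 b1 hab
      obtain ⟨w2m, w2a, w2b, hset2⟩ := third_vertex v2 a2 b2 hab
      set w1 := tv0 t1 + tv1 t1 + tv2 t1 - a - b with hw1
      set w2 := tv0 t2 + tv1 t2 + tv2 t2 - a - b with hw2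
      have hw12 : w1 ≠ w2 := by
        intro e
        apply ht12
        exact eq_of_tset_eq v1 v2 (by rw [hset1, hset2, e])
      -- the four contacts
      have hap : s.apexes a b = [w2, w1] := by
        rw [apexes_eq, ← hF, hF12]; simp [hw1, hw2]
      obtain ⟨-, hall⟩ := hcond
      rw [hap] at hall
      simp only [List.all_cons, List.all_nil, Bool.and_true, Bool.and_eq_true, beq_iff_eq] at hall
      obtain ⟨⟨h2a, h2b⟩, ⟨h1a, h1b⟩⟩ := hall
      have w1_12 : w1 < 12 := lt_of_mem_tset v1 w1m
      have w2_12 : w2 < 12 := lt_of_mem_tset v2 w2m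
      have contact : ∀ {w x : ℕ}, w < 12 → x < 12 → w ≠ x → s.gdom w x = 0 → M.g w x = 1 / 2 := by
        intro w x hw hx hwx h0
        rcases hR.dom w x hw hx hwx with h | ⟨-, h⟩ | ⟨-, h, -⟩
        · rw [h0] at h; exact absurd h (by unfold UNL; norm_num)
        · exact h
        · exact absurd h0 h
      have g1a := contact w1_12 ha w1a h1a
      have g1b := contact w1_12 hb w1b h1b
      have g2a := contact w2_12 ha w2a h2a
      have g2b := contact w2_12 hb w2b h2b
      have T1 : ({a, b, w1} : Finset ℕ) ∈ M.T := by rw [← hset1]; exact hR.mem t1 ht1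
      have T2 : ({a, b, w2} : Finset ℕ) ∈ M.T := by rw [← hset2]; exact hR.mem t2 ht2
      have hnn : 0 ≤ M.g a b := M.pairing a b w1 w2 hab hw12 T1 T2 g1a g1b g2a g2b
      -- the cells
      rw [ZCELL_eq]
      by_cases hkill : rHi (s.gdom a b) < max (rLo (s.gdom a b)) 11
      · rw [if_pos hkill]
        exfalso
        have hlt : rHi (s.gdom a b) < 11 := by omega
        have := gridPt_neg (κ := κ) hlt
        have : ((gridPt κ (rHi (s.gdom a b)) : ℚ) : ℝ) < 0 := by exact_mod_cast this
        linarith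
      · rw [if_neg hkill]
        by_cases hsame : max (rLo (s.gdom a b)) 11 = rLo (s.gdom a b)
        · rw [if_pos hsame]; exact ⟨by simp, fun s' h => by cases h; exact ⟨hR, rfl⟩⟩
        · rw [if_neg hsame]
          refine ⟨by simp, fun s' h => ?_⟩
          cases h
          refine ⟨hR.sdom ha hb hab hrU ?_ ?_, rfl⟩
          · unfold mkR UNL; have : K = 15 := rfl; omega
          · have hmax : max (rLo (s.gdom a b)) 11 = 11 := by omega
            rw [hmax]
            have hhi : 11 ≤ rHi (s.gdom a b) := by omega
            have vnew : ValidDom (mkR 11 (rHi (s.gdom a b))) := validDom_mkR (by norm_num) hhi hl3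
            have elo : rLo (mkR 11 (rHi (s.gdom a b))) = 11 := by unfold rLo mkR; have : K = 15 := rfl; omega
            have ehi : rHi (mkR 11 (rHi (s.gdom a b))) = rHi (s.gdom a b) := by
              unfold rHi mkR; have : K = 15 := rfl; omega
            right; right
            refine ⟨vnew, by unfold mkR; omega, hxne, ?_, ?_⟩
            · rw [elo]
              have := gridPt_neg (κ := κ) (by norm_num : 10 < 11)
              have : ((gridPt κ 10 : ℚ) : ℝ) < 0 := by exact_mod_cast this
              exact le_trans this.le hnn
            · rw [ehi]; exact hxhi
    · rw [if_neg hcond]; exact ⟨by simp, fun s' h => by cases h; exact ⟨hR, rfl⟩⟩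

/-- **Soundness of `pairRulesAt`.** [folklore] -/
theorem pairRulesAt_sound {M : KConf κ} {s : St} (hR : Realizes M s) {v : ℕ} (hv : v < 12) :
    s.pairRulesAt v ≠ none ∧ ∀ s', s.pairRulesAt v = some s' → Realizes M s' ∧ s'.tris = s.tris := by
  unfold St.pairRulesAt
  rw [foldRange_eq_foldl]
  have hf : ∀ (s1 : St) (u : ℕ), u ∈ List.range' 0 12 → Realizes M s1 →
      ((if u = v then some s1 else s1.pairRuleAt u v) ≠ none ∧
        ∀ s', (if u = v then some s1 else s1.pairRuleAt u v) = some s' → Realizes M s' ∧ s'.tris = s1.tris) := by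
    intro s1 u hu hs1
    rw [List.mem_range'_1] at hu
    by_cases huv : u = v
    · rw [if_pos huv]; exact ⟨by simp, fun s' h => by cases h; exact ⟨hs1, rfl⟩⟩
    · rw [if_neg huv]; exact pairRuleAt_sound hs1 (by omega) hv huv
  exact fold_opt_sound (M := M) (List.range' 0 12) (fun s1 u => if u = v then some s1 else s1.pairRuleAt u v) hf s hR


end GSearch

end Summit.Ventures.Crystal3D.Kissing125
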